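import Summits.BirchSwinnertonDyer.BirchSwinnertonDyer.Theorems.ThetaPartnerAtTwoSignedKatoUpToAtTwoLayerShapiroAwayVanishing
import Literature.NumberTheory.GaloisCohomology.BrauerSumTwoTorsionAtOnePlace
import HarnessLib

/-!
# Route `ThetaPartnerAtTwo` (TP2), crux K3 `SignedKatoDivisibilityUpToAtTwo` (item stmt-BirchSwinnertonDyer-20308) /
# K3P′ (item 25631), line `colemanrat` v7 — (PT-orth) ASSEMBLY, step S2/T2: Poitou–Tate along the layer `K_N` in the
# SHAPIRO model, reduced to the level-transport identity: `2 • inv_{v₀}(loc_{v₀}(a ∪ Sh[ψ])) = 0`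

Lead `bsd-wall-tp2-p2x` g5 (cell `bsd-wall`). HONEST FRAMING: THEOREMS ONLY (no definition, no named fact, no instance, no `sorry`);
closes no item; BSD is NOT proved by any of this. This is a CONDITIONAL assembly: its hypothesis `htrans` (level transport of the
global cup classes, brick [S2-B3] of the lead's S2 architecture) is theorem-shaped and is being built from the tree's Weil tower
(`WeilPairingLevelCompatProofs`), `shapiroLift_cohomologyMap` and `ContPairing.cupProduct_coindFin_map` by the width seats.

## The statement (any number field `K : Type`, prime `p`, `ℤ_p`-extension `κ`, layer `N`, `W/K` elliptic)
Let `v₀` be a finite place such that every OTHER finite place is prime to `p` (e.g. `K = ℚ`, `v₀ = (p)`), `t ∈ Sel_{p^∞}(E/K_N)` with a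
cocycle `φ_N`, and for every level `L ≥ L₀` a finite-level lift `ψ_L : Γ_N → E[p^L]` of `φ_N` (`…LayerLocalTrivialityFinite`). For every
level let a first factor `a_L ∈ H¹(Γ_K, A_L)` and a continuous pairing `P_L : A_L × Maps(Γ_K ⧸ Γ_N, E[p^L]) → μ_{p^L}` be given (in the
application: `A_L = Maps(Γ_K ⧸ Γ_N, E[p^L])`, `a_L = Sh(red_{p^L} x)` for `x ∈ H¹(Γ_N, T_pE)`, `P_L` = the summed Weil pairing), and put
`c_L := a_L ∪_{P_L} Sh_{Γ_N}[ψ_L] ∈ H²(Γ_K, μ_{p^L})`. IF the classes are compatible under `μ_{p^{L₀}} ↪ μ_{p^L}` (`htrans`: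
`c_L = ι_* c_{L₀}`), THEN

  `2 • inv_{v₀}(loc_{v₀} c_{L₀}) = 0`.

Proof: at every finite `v ≠ v₀` (so `v ∤ p`) the localisation of `c_L` VANISHES for all large `L` (`…LayerShapiroAwayVanishing`: the
restriction of `Sh[ψ_L]` to `Γ_{K_v}` is a coboundary by the conjugate local triviality of layer Selmer classes at a `v`-dependent level,
`…LayerLocalTrivialityFinite.exists_level_forall_conj_apply_eq_smul_sub_of_dvd`), hence `loc_v(ι_* c_{L₀}) = 0`; Tate's reciprocity law
for THE invariant maps with the real places `2`-torsion then gives the claim (`two_nsmul_localInvariantMap_eq_zero_of_forall_ne_levels`).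
This is Kobayashi (7.17)–(7.20) / Kato §17.13 at finite level, for `p = 2` with the honest factor `2` (`m = 1` in (PT-orth)).

## What is proved
* `two_nsmul_localInvariantMap_cup_shapiroLift_eq_zero` — the displayed statement.

What remains for (PT-orth) (lead's bricks S2-B3 / T3, not here): the transport identity `htrans` for the Weil/Shapiro cup classes, and the
identification of `inv_{v₀}(loc_{v₀} c_{L₀})` with the (D-layer) layer pairing `layerPairingMod` (one double coset at `v₀ ∣ p`:
`ContinuousShapiroLiftRestrictHom.map_cupProduct_coindFin_shapiroLift`).

References: [Kobayashi2003] (7.16)–(7.21) (p. 12); [Kato2004Asterisque] §17.13 (p. 279); [MilneADT2006] Ch. I Thm. 4.10 (b), Ex. 1.6 (c);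
[CasselsFrohlichANT1967] Ch. VII §11; [SerreLocalFields1979] XIII §3 Cor. 3.
-/

set_option autoImplicit false
-- the Theorems namespace of this sub repeats the summit name by design (D-0017 nested layout)
set_option linter.dupNamespace false

noncomputable section

open scoped Classical

namespace Summit.BirchSwinnertonDyer.BirchSwinnertonDyer.Theorems

namespace SignedKatoOffTwo.LayerPT

open CategoryTheory NumberField IsDedekindDomain Field WeierstrassCurve ContinuousCohomology
  Literature.NumberTheory.EllipticCurves Literature.NumberTheory.EllipticCurves.GreenbergSelmer
  Literature.NumberTheory.GaloisRepresentations Literature.NumberTheory.GaloisRepresentations.DiscreteGaloisModule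
  Literature.NumberTheory.GaloisCohomology ZpExtension

variable {K : Type} [Field K] [NumberField K] (W : WeierstrassCurve K) [W.IsElliptic] {p : ℕ} [hp : Fact p.Prime]
  (κ : ZpExtension K p) (N : ℕ)
  {s : absoluteGaloisGroup K ⧸ κ.layerSubgroup N → absoluteGaloisGroup K}
  (hs : ∀ x, (s x : absoluteGaloisGroup K ⧸ κ.layerSubgroup N) = x)
  (hs1 : s ((1 : absoluteGaloisGroup K) : absoluteGaloisGroup K ⧸ κ.layerSubgroup N) = 1)

/-- **Poitou–Tate along the layer `K_N`, Shapiro model, modulo level transport.** See the module docstring: for a layer Selmer class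
`t ∈ Sel_{p^∞}(E/K_N)` with cocycle `φ_N`, finite-level lifts `ψ_L` (`L ≥ L₀`), arbitrary first factors `a_L` and pairings `P_L` into
`μ_{p^L}`, and the cup classes `c_L = a_L ∪ Sh[ψ_L]`: if `c_L = ι_* c_{L₀}` for all `L ≥ L₀` and `v₀` is the only finite place above `p`,
then `2 • inv_{v₀}(loc_{v₀} c_{L₀}) = 0`. [cite: Kobayashi2003, (7.16)–(7.21) (p. 12)] [cite: MilneADT2006, Ch. I, Thm. 4.10(b)]
[cite: CasselsFrohlichANT1967, Ch. VII §11] -/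
theorem two_nsmul_localInvariantMap_cup_shapiroLift_eq_zero [Fintype (absoluteGaloisGroup K ⧸ κ.layerSubgroup N)]
    (v₀ : HeightOneSpectrum (𝓞 K)) (hv₀ : ∀ v : HeightOneSpectrum (𝓞 K), v ≠ v₀ → ((p : ℕ) : 𝓞 K) ∉ v.asIdeal)
    {t : W.subgroupH1 p (κ.layerSubgroup N)} (ht : t ∈ W.selmerLayer κ N)
    (φN : contOneCocycles (discreteTopRep (κ.layerSubgroup N) (W.geomPrimaryTorsion p))) (hφN : oneCocycleClass _ φN = t)
    (L₀ : ℕ)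
    (ψ : ∀ L : ℕ, L₀ ≤ L →
      contOneCocycles (subgroupRep (W.torsionGaloisModule ((p ^ L : ℕ) : ℤ)).toTopRep (κ.layerSubgroup N)))
    (hψ : ∀ (L : ℕ) (hL : L₀ ≤ L) (x : κ.layerSubgroup N),
      (((ψ L hL).1 x : geomTorsion W ((p ^ L : ℕ) : ℤ)) : W.geomPoints) = ((φN.1 x : W.geomPrimaryTorsion p) : W.geomPoints))
    (A : ∀ L : ℕ, L₀ ≤ L → TopRep.{0} ℤ (absoluteGaloisGroup K))
    (P : ∀ (L : ℕ) (hL : L₀ ≤ L), ContPairing (A L hL)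
      (coindFin (W.torsionGaloisModule ((p ^ L : ℕ) : ℤ)).toTopRep (κ.layerSubgroup N)) (mu K (p ^ L)).toTopRep)
    (a : ∀ (L : ℕ) (hL : L₀ ≤ L), continuousCohomology 1 (A L hL))
    (htrans : ∀ (L : ℕ) (hL : L₀ ≤ L),
      haveI : CompactSpace (absoluteGaloisGroup K) := absoluteGaloisGroup_compactSpace K
      (P L hL).cupProduct (a L hL)
          (shapiroLift (W.torsionGaloisModule ((p ^ L : ℕ) : ℤ)).toTopRep (κ.layerSubgroup N) (κ.isOpen_layerSubgroup N) hs hs1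
            (oneCocycleClass _ (ψ L hL))) =
        cohomologyMap (muInclHom K (pow_dvd_pow p hL)) 2
          ((P L₀ le_rfl).cupProduct (a L₀ le_rfl)
            (shapiroLift (W.torsionGaloisModule ((p ^ L₀ : ℕ) : ℤ)).toTopRep (κ.layerSubgroup N) (κ.isOpen_layerSubgroup N) hs hs1
              (oneCocycleClass _ (ψ L₀ le_rfl))))) :
    haveI : CompactSpace (absoluteGaloisGroup K) := absoluteGaloisGroup_compactSpace K
    2 • localInvariantMap K (p ^ L₀) v₀ (galoisCohomology.localization (mu K (p ^ L₀)) (Sum.inr v₀) 2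
      ((P L₀ le_rfl).cupProduct (a L₀ le_rfl)
        (shapiroLift (W.torsionGaloisModule ((p ^ L₀ : ℕ) : ℤ)).toTopRep (κ.layerSubgroup N) (κ.isOpen_layerSubgroup N) hs hs1
          (oneCocycleClass _ (ψ L₀ le_rfl))))) = 0 := by
  haveI : CompactSpace (absoluteGaloisGroup K) := absoluteGaloisGroup_compactSpace K
  refine two_nsmul_localInvariantMap_eq_zero_of_forall_ne_levels K (p ^ L₀) v₀ _ fun v hv ↦ ?_
  haveI : CompactSpace (absoluteGaloisGroup (v.adicCompletion K)) := absoluteGaloisGroup_compactSpace (v.adicCompletion K)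
  -- the `v`-dependent level at which the conjugate local restrictions of `ψ` are principal in `E[p^L]`
  obtain ⟨j, hj⟩ := LayerFinite.exists_level_forall_conj_apply_eq_smul_sub_of_dvd W κ v N ht (hv₀ v hv) s φN hφN
  let L : ℕ := max L₀ j
  have hL : L₀ ≤ L := le_max_left L₀ j
  have hdvd : ((p ^ j : ℕ) : ℤ) ∣ ((p ^ L : ℕ) : ℤ) := by exact_mod_cast pow_dvd_pow p (le_max_right L₀ j)
  refine ⟨p ^ L, inferInstance, pow_dvd_pow p hL, ?_⟩
  rw [← htrans L hL]
  exact LayerShapiro.map_cupProduct_shapiroLift_eq_zero_of_decomp (W.torsionGaloisModule ((p ^ L : ℕ) : ℤ)).toTopRep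
    (κ.layerSubgroup N) (κ.isOpen_layerSubgroup N) hs hs1 v (P L hL) (a L hL) (ψ L hL)
    fun y₀ ↦ hj ((p ^ L : ℕ) : ℤ) hdvd (ψ L hL) (hψ L hL) y₀

end SignedKatoOffTwo.LayerPT

end Summit.BirchSwinnertonDyer.BirchSwinnertonDyer.Theorems

end
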